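import Mathlib.GroupTheory.FreeGroup.NielsenSchreier
import Mathlib.GroupTheory.Index
import Mathlib.GroupTheory.OrderOfElement
import Mathlib.Algebra.Group.Conj
import Literature.GroupTheory.CombinatorialGroupTheory.FreeGroupConjugacySeparable
import Literature.GroupTheory.CombinatorialGroupTheory.FreeGroupCommutingPowers
import HarnessLib

/-!
# The centralizer condition for free groups, in finite form

Topic `Literature/GroupTheory/CombinatorialGroupTheory`; theorems only.  For a free group `H`
(any `IsFreeGroup H`), an element `z ∈ H` and a normal subgroup `M` of finite index, there is a
normal subgroup `M' ≤ M` of finite index such that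

  every `f ∈ H` with `f z f⁻¹ ≡ z (mod M')` lies in `C_H(z) · M`

(`VirtuallyFree.exists_normal_le_forall_conj_mk_eq_imp`).  This is the statement, read in the
finite quotients of `H`, that the centralizer of `z` in the profinite completion `Ĥ` is the closure
of the discrete centralizer `C_H(z)` (the "centralizer condition"; cf. the tree's profinite form
`Literature.IUT.HodgeTheaters.ProfiniteCompletion.centralizer_toCompletion_eq_closure_of_isFreeGroup`).
It is the free-group input of the conjugacy separability of elements of infinite order in
free-by-finite groups (J. L. Dyer 1979; see `VirtuallyFreeConjugacyInfiniteOrder.lean`, which imports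
this file), proved here over the tree's conjugacy separability of free groups
(`FreeGroup.exists_normal_finiteIndex_not_isConj`, Stebe 1970 / Lyndon–Schupp Ch. I Prop. 4.8) and
the cyclicity of centralizers in free groups (Lyndon–Schupp Ch. I Prop. 2.19, tree
`FreeGroupCommutingPowers`).  Also recorded: conjugacy separability transported from `FreeGroup ι`
to an arbitrary `IsFreeGroup` (`VirtuallyFree.exists_normal_finiteIndex_not_isConj_of_isFreeGroup`,
`VirtuallyFree.isConj_of_forall_isConj_of_isFreeGroup`).

## Proof of the centralizer condition

Put `e = [H : M]`, so `z^e ∈ M`.  Fix a coset `t M` with `t ∉ C_H(z)·M`.  The elements `z^e` and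
`t⁻¹ z^e t` of the subgroup `M` — a FREE group by the Nielsen–Schreier theorem (Mathlib) — are not
conjugate in `M`: `m z^e m⁻¹ = t⁻¹ z^e t` with `m ∈ M` would put `t m` in `C_H(z^e) = C_H(z)`
(`commute_of_commute_pow`).  Conjugacy separability of `M` gives a normal `L ⊴ M` of finite index
separating them; the normal core `M''` in `H` of `L` then has the property that NO `f = t m ∈ t M`
centralizes `z` modulo `M''` (raise `f z f⁻¹ ≡ z` to the `e`-th power and read it in `M ⧸ L`).
Intersecting the `M''` over a system of representatives of the finitely many cosets of `M` gives `M'`.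

## References

* R. C. Lyndon, P. E. Schupp, *Combinatorial Group Theory*, Springer (1977); Classics in Mathematics
  (2001), Ch. I Prop. 4.8 (conjugacy separability of free groups), Prop. 2.19 (centralizers).
  [LyndonSchupp2001]
* J. L. Dyer, *Separating conjugates in amalgamated free products and HNN extensions*, J. Austral.
  Math. Soc. Ser. A 29 (1980) 35–51, §1–§2 p. 36 (the use: Dyer 1979's theorem). [Dyer1980]
-/

namespace Literature.GroupTheory.CombinatorialGroupTheory

universe u

namespace VirtuallyFree

/-! ### Conjugacy separability of free groups, for any `IsFreeGroup` -/

/-- **Conjugacy separability of free groups**, transported to an arbitrary free group `H`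
(`IsFreeGroup H`): non-conjugate elements have non-conjugate images in some finite quotient.
[cite: LyndonSchupp2001, Ch. I Prop. 4.8] -/
theorem exists_normal_finiteIndex_not_isConj_of_isFreeGroup {H : Type u} [Group H] [IsFreeGroup H]
    {u v : H} (h : ¬ IsConj u v) :
    ∃ (K : Subgroup H) (_ : K.Normal), K.FiniteIndex ∧
      ¬ IsConj (QuotientGroup.mk u : H ⧸ K) (QuotientGroup.mk v) := by
  let e : H ≃* FreeGroup (IsFreeGroup.Generators H) := IsFreeGroup.toFreeGroup H
  have h' : ¬ IsConj (e u) (e v) := by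
    intro hc
    apply h
    have := e.symm.toMonoidHom.map_isConj hc
    simpa using this
  obtain ⟨K₀, hK₀n, hK₀f, hK₀⟩ := FreeGroup.exists_normal_finiteIndex_not_isConj h'
  haveI := hK₀n
  refine ⟨K₀.comap e.toMonoidHom, inferInstance, ?_, ?_⟩
  · constructor
    rw [Subgroup.index_comap_of_surjective _ e.surjective]
    exact hK₀f.index_ne_zero
  · intro hc
    apply hK₀
    have hle : K₀.comap e.toMonoidHom ≤ K₀.comap e.toMonoidHom := le_rfl
    have hmk : ∀ w : H, QuotientGroup.map (K₀.comap e.toMonoidHom) K₀ e.toMonoidHom hle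
        (QuotientGroup.mk w) = QuotientGroup.mk (e w) := fun w => rfl
    have := (QuotientGroup.map (K₀.comap e.toMonoidHom) K₀ e.toMonoidHom hle).map_isConj hc
    rwa [hmk, hmk] at this

/-- Contrapositive form: elements of a free group `H` that are conjugate in every finite quotient of
`H` are conjugate. [cite: LyndonSchupp2001, Ch. I Prop. 4.8] -/
theorem isConj_of_forall_isConj_of_isFreeGroup {H : Type u} [Group H] [IsFreeGroup H] {u v : H}
    (h : ∀ (K : Subgroup H) [K.Normal] [K.FiniteIndex],
      IsConj (QuotientGroup.mk u : H ⧸ K) (QuotientGroup.mk v)) :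
    IsConj u v := by
  by_contra huv
  obtain ⟨K, hKn, hKf, hK⟩ := exists_normal_finiteIndex_not_isConj_of_isFreeGroup huv
  exact hK (h K)

/-! ### The finite form of the centralizer condition in a free group -/

/-- In a free group, an element commuting with a non-trivial power `z ^ e` (`e ≠ 0`) commutes with
`z`. [cite: LyndonSchupp2001, Ch. I Prop. 2.19] -/
theorem commute_of_commute_pow_left {H : Type u} [Group H] [IsFreeGroup H] {z c : H} {e : ℕ}
    (he : e ≠ 0) (h : Commute c (z ^ e)) : Commute c z :=
  (commute_of_commute_pow he h.symm).symm

/-- **The centralizer condition for free groups, finite form.**  Let `H` be a free group, `z ∈ H`,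
and `M` a normal subgroup of finite index.  Then there is a normal subgroup `M' ≤ M` of finite index
such that every `f ∈ H` with `f z f⁻¹ ≡ z (mod M')` lies in `C_H(z) · M`: `f = c m` with `c z = z c`
and `m ∈ M`.  (Equivalently: the centralizer of `z` in the profinite completion `Ĥ` is the closure
of `C_H(z)`.)  Proof: conjugacy separability of the free subgroup `M` (Nielsen–Schreier) applied to
`z^[H:M]` and its conjugates `t⁻¹ z^[H:M] t`, `t ∉ C_H(z)·M`, together with `C_H(z^e) = C_H(z)`.
[cite: LyndonSchupp2001, Ch. I Prop. 4.8] -/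
theorem exists_normal_le_forall_conj_mk_eq_imp {H : Type u} [Group H] [IsFreeGroup H] (z : H)
    (M : Subgroup H) [hMn : M.Normal] [hMf : M.FiniteIndex] :
    ∃ M' : Subgroup H, M'.Normal ∧ M'.FiniteIndex ∧ M' ≤ M ∧
      ∀ f : H, (QuotientGroup.mk (f * z * f⁻¹) : H ⧸ M') = QuotientGroup.mk z →
        ∃ c : H, Commute c z ∧ c⁻¹ * f ∈ M := by
  classical
  set e : ℕ := M.index with he_def
  have he : e ≠ 0 := hMf.index_ne_zero
  have hzM : z ^ e ∈ M := M.pow_index_mem z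
  -- the property wanted on one coset `t • M`
  have key : ∀ t : H, ∃ M'' : Subgroup H, M''.Normal ∧ M''.FiniteIndex ∧ M'' ≤ M ∧
      ∀ m ∈ M, (QuotientGroup.mk ((t * m) * z * (t * m)⁻¹) : H ⧸ M'') = QuotientGroup.mk z →
        ∃ c : H, Commute c z ∧ c⁻¹ * (t * m) ∈ M := by
    intro t
    by_cases hgood : ∃ c : H, Commute c z ∧ c⁻¹ * t ∈ M
    · obtain ⟨c, hcz, hct⟩ := hgood
      refine ⟨M, hMn, hMf, le_rfl, fun m hm _ => ⟨c, hcz, ?_⟩⟩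
      have : c⁻¹ * (t * m) = (c⁻¹ * t) * m := by group
      rw [this]
      exact M.mul_mem hct hm
    · -- the two non-conjugate elements of the free group `M`
      let u : M := ⟨z ^ e, hzM⟩
      have hvM : t⁻¹ * z ^ e * t ∈ M := by
        have := hMn.conj_mem _ hzM t⁻¹
        simpa using this
      let v : M := ⟨t⁻¹ * z ^ e * t, hvM⟩
      have huv : ¬ IsConj u v := by
        intro hc
        obtain ⟨d, hd⟩ := isConj_iff.mp hc
        apply hgood
        have hd' : (d : H) * z ^ e * (d : H)⁻¹ = t⁻¹ * z ^ e * t := by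
          have := congrArg Subtype.val hd
          simpa [u, v] using this
        -- `c := t d` centralizes `z ^ e`, hence `z`
        refine ⟨t * d, ?_, ?_⟩
        · apply commute_of_commute_pow_left he
          change (t * d) * z ^ e = z ^ e * (t * d)
          have h1 : (t * d) * z ^ e * (t * d)⁻¹ = z ^ e := by
            rw [show (t * ↑d) * z ^ e * (t * ↑d)⁻¹ = t * ((d : H) * z ^ e * (d : H)⁻¹) * t⁻¹ by group,
              hd']
            group
          calc (t * d) * z ^ e = ((t * d) * z ^ e * (t * d)⁻¹) * (t * d) := by group
            _ = z ^ e * (t * d) := by rw [h1]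
        · have : (t * (d : H))⁻¹ * t = (d : H)⁻¹ := by group
          rw [this]
          exact M.inv_mem d.2
      -- separate them in a finite quotient of `M`, then take the normal core in `H`
      obtain ⟨L, hLn, hLf, hL⟩ := exists_normal_finiteIndex_not_isConj_of_isFreeGroup huv
      haveI := hLn
      haveI := hLf
      let L₁ : Subgroup H := L.map M.subtype
      haveI hL₁f : L₁.FiniteIndex := by
        constructor
        rw [Subgroup.index_map_subtype]
        exact mul_ne_zero hLf.index_ne_zero he
      refine ⟨L₁.normalCore, inferInstance, inferInstance,
        (Subgroup.normalCore_le L₁).trans (Subgroup.map_subtype_le L), ?_⟩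
      intro m hm hconj
      exfalso
      apply hL
      -- `m z^e m⁻¹ ≡ t⁻¹ z^e t (mod core L₁)`
      have hpow : (QuotientGroup.mk ((t * m) * z ^ e * (t * m)⁻¹) : H ⧸ L₁.normalCore) =
          QuotientGroup.mk (z ^ e) := by
        have h1 : (t * m) * z ^ e * (t * m)⁻¹ = ((t * m) * z * (t * m)⁻¹) ^ e := by
          rw [conj_pow]
        rw [h1, QuotientGroup.mk_pow, hconj, QuotientGroup.mk_pow]
      have hmem : (m * z ^ e * m⁻¹)⁻¹ * (t⁻¹ * z ^ e * t) ∈ L₁.normalCore := by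
        rw [← QuotientGroup.eq]
        have ht : (QuotientGroup.mk (m * z ^ e * m⁻¹) : H ⧸ L₁.normalCore) =
            QuotientGroup.mk t⁻¹ * QuotientGroup.mk ((t * m) * z ^ e * (t * m)⁻¹) *
              QuotientGroup.mk t := by
          rw [← QuotientGroup.mk_mul, ← QuotientGroup.mk_mul]
          congr 1
          group
        rw [ht, hpow, ← QuotientGroup.mk_mul, ← QuotientGroup.mk_mul]
      have hmem₁ : (m * z ^ e * m⁻¹)⁻¹ * (t⁻¹ * z ^ e * t) ∈ L₁ := Subgroup.normalCore_le L₁ hmem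
      -- read this inside `M ⧸ L`
      let mM : M := ⟨m, hm⟩
      have hval : (((mM * u * mM⁻¹)⁻¹ * v : M) : H) = (m * z ^ e * m⁻¹)⁻¹ * (t⁻¹ * z ^ e * t) := by
        simp [mM, u, v, mul_assoc]
      have hinL : (mM * u * mM⁻¹)⁻¹ * v ∈ L := by
        obtain ⟨w, hw, hwval⟩ := Subgroup.mem_map.mp hmem₁
        have : w = (mM * u * mM⁻¹)⁻¹ * v := Subtype.ext (by rw [hval]; exact hwval)
        rw [← this]
        exact hw
      have heq : (QuotientGroup.mk (mM * u * mM⁻¹) : ↥M ⧸ L) = QuotientGroup.mk v :=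
        QuotientGroup.eq.mpr hinL
      refine isConj_iff.mpr ⟨QuotientGroup.mk mM, ?_⟩
      rw [← QuotientGroup.mk_mul, ← QuotientGroup.mk_inv, ← QuotientGroup.mk_mul, heq]
  choose M'' hM''n hM''f hM''le hP using key
  -- intersect over a (finite) system of coset representatives
  haveI : Finite (H ⧸ M) := Subgroup.finite_quotient_of_finiteIndex
  let M' : Subgroup H := ⨅ q : H ⧸ M, M'' q.out
  haveI hM'n : M'.Normal := Subgroup.normal_iInf_normal fun q => hM''n q.out
  haveI hM'f : M'.FiniteIndex := Subgroup.finiteIndex_iInf fun q => hM''f q.out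
  refine ⟨M', hM'n, hM'f, (iInf_le _ (QuotientGroup.mk 1 : H ⧸ M)).trans (hM''le _), ?_⟩
  intro f hf
  obtain ⟨h, hh⟩ := QuotientGroup.mk_out_eq_mul M f
  set t : H := (QuotientGroup.mk f : H ⧸ M).out with ht_def
  have hf_eq : f = t * (h : H)⁻¹ := by rw [hh]; group
  have hm : ((h : H)⁻¹) ∈ M := M.inv_mem h.2
  have hle : M' ≤ M'' t := iInf_le _ (QuotientGroup.mk f)
  have hconj' : (QuotientGroup.mk ((t * (h : H)⁻¹) * z * (t * (h : H)⁻¹)⁻¹) : H ⧸ M'' t) =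
      QuotientGroup.mk z := by
    rw [← hf_eq]
    have := (QuotientGroup.map M' (M'' t) (MonoidHom.id H) hle)
    have hmap := congrArg (QuotientGroup.map M' (M'' t) (MonoidHom.id H) hle) hf
    simpa using hmap
  obtain ⟨c, hcz, hcm⟩ := hP t _ hm hconj'
  exact ⟨c, hcz, by rwa [hf_eq]⟩


end VirtuallyFree

end Literature.GroupTheory.CombinatorialGroupTheory
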